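import Literature.Analysis.FluidPDE.TaoCascadeZeroScalePhase
import HarnessLib

/-!
# Tao's cascade ODE, §6.7: the early phase `0 ≤ t ≤ T` — uniform bounds on `b₀, c₀` ((6.147)–(6.148))

T. Tao, *Finite time blowup for an averaged three-dimensional Navier–Stokes equation*,
J. Amer. Math. Soc. **29** (2016), 601–674 = arXiv:1402.0290v3, §6.7, (6.147)–(6.148): with
`Ẽ₀ ≤ 1` on `[0, T]` (so `a₀² ≤ 2`), (6.147) gives the affine bound
`|b₀(t)|, |c₀(t)| ≤ √(b₀(0)²+c₀(0)²) + (2√2ε + √2η)t` and then (6.148), by Grönwall with the rate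
`ε⁻¹K^{10}|b₀|`, a bound on `|c₀(t)|` by an explicit exponential of a quadratic in `t` times the
initial value and the source `2ε²e^{-K^{10}} + η` (`η = C₁(1+ε₀)^{-n₀/2}`). This file records these two
uniform-in-`[0,T]` bounds over `RescaledHypotheses γ …` (`early_b_abs_le`, `early_c_abs_le`),
chaining `zero_bc_growth`, `zero_c_abs_le` (`TaoCascadeZeroScalePhase.lean`) and
`integral_abs_mul_le_of_affine` (`TaoCascadeZeroScale.lean`); the crude `a₀² ≤ 2` (instead of the
source's `1 + O(K⁻¹)` from (6.146)) costs only numerical constants in the exponent.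

## References

* T. Tao, J. Amer. Math. Soc. 29 (2016), 601–674, arXiv:1402.0290v3, §6.7 (6.147)–(6.148).
  [`Tao2016AveragedNS`]
-/

noncomputable section

open Set MeasureTheory intervalIntegral

namespace Literature.Analysis.FluidPDE

namespace TaoCascade

open Literature.Analysis.ODE

section Early

variable {γ ε₀ K ε C₁ C₂ C₃ : ℝ} {n₀ N : ℤ} {τ : ℤ → ℝ} {Xr : Fin 4 → ℤ → ℝ → ℝ} {Er : ℤ → ℝ → ℝ}

/-- **(6.147) on `[0, T]`, uniform form**: with `Ẽ₀ ≤ 1` there and `0 < ε ≤ 1`,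
`|b₀(t)| ≤ √(b₀(0)²+c₀(0)²) + (2√2ε + √2η)·t` and the same for `|c₀(t)|` (`η = C₁(1+ε₀)^{-n₀/2}`).
[cite: Tao2016AveragedNS, §6.7 (6.147)] -/
theorem RescaledHypotheses.early_bc_abs_le
    (h : RescaledHypotheses γ ε₀ K ε C₁ C₂ C₃ n₀ N τ Xr Er) (hε : 0 < ε) (hε1 : ε ≤ 1) (hC₁ : 0 ≤ C₁)
    (hε₀ : 0 < ε₀) {T : ℝ} (hτ0 : τ (n₀ - N) ≤ 0) (hreg : ∀ t ∈ Icc 0 T, Er 0 t ≤ 1)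
    {t : ℝ} (ht : t ∈ Icc 0 T) :
    |Xr 1 0 t| ≤ Real.sqrt (Xr 1 0 0 ^ 2 + Xr 2 0 0 ^ 2) +
        (Real.sqrt 2 * ε * Real.sqrt 2 ^ 2 + Real.sqrt 2 * (C₁ * (1 + ε₀) ^ (-((n₀ : ℝ) / 2)))) * t ∧
      |Xr 2 0 t| ≤ Real.sqrt (Xr 1 0 0 ^ 2 + Xr 2 0 0 ^ 2) +
        (Real.sqrt 2 * ε * Real.sqrt 2 ^ 2 + Real.sqrt 2 * (C₁ * (1 + ε₀) ^ (-((n₀ : ℝ) / 2)))) * t := by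
  have hA : ∀ s ∈ Icc 0 T, Xr 0 0 s ^ 2 ≤ Real.sqrt 2 ^ 2 := by
    intro s hs
    rw [Real.sq_sqrt (by norm_num)]
    have := h.sq_le_two_mul_energy 0 0 (hτ0.trans hs.1)
    linarith [hreg s hs]
  have hg := h.zero_bc_growth hε hε1 hC₁ hε₀ hτ0 hreg hA ht
  rw [sub_zero] at hg
  have hb : |Xr 1 0 t| ≤ Real.sqrt (Xr 1 0 t ^ 2 + Xr 2 0 t ^ 2) := by
    rw [← Real.sqrt_sq_eq_abs]; exact Real.sqrt_le_sqrt (by nlinarith)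
  have hc : |Xr 2 0 t| ≤ Real.sqrt (Xr 1 0 t ^ 2 + Xr 2 0 t ^ 2) := by
    rw [← Real.sqrt_sq_eq_abs]; exact Real.sqrt_le_sqrt (by nlinarith)
  exact ⟨hb.trans hg, hc.trans hg⟩

/-- **(6.148) on `[0, T]`, uniform form.** With `Ẽ₀ ≤ 1` on `[0, T]`, `0 < ε ≤ 1`, write
`p = √(b₀(0)²+c₀(0)²)`, `σ = 2√2ε + √2η`, `η = C₁(1+ε₀)^{-n₀/2}`. Then for `t ∈ [0, T]`:
`|c₀(t)| ≤ exp(ε⁻¹K^{10}(p t + σ t²/2)) · (|c₀(0)| + (2ε²e^{-K^{10}} + η) t)`.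
[cite: Tao2016AveragedNS, §6.7 (6.148)] -/
theorem RescaledHypotheses.early_c_abs_le
    (h : RescaledHypotheses γ ε₀ K ε C₁ C₂ C₃ n₀ N τ Xr Er) (hε : 0 < ε) (hε1 : ε ≤ 1) (hC₁ : 0 ≤ C₁)
    (hε₀ : 0 < ε₀) {T : ℝ} (hτ0 : τ (n₀ - N) ≤ 0) (hreg : ∀ t ∈ Icc 0 T, Er 0 t ≤ 1)
    {t : ℝ} (ht : t ∈ Icc 0 T) :
    |Xr 2 0 t| ≤
      Real.exp (|ε⁻¹ * K ^ 10| *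
          (Real.sqrt (Xr 1 0 0 ^ 2 + Xr 2 0 0 ^ 2) * t +
            (Real.sqrt 2 * ε * Real.sqrt 2 ^ 2 + Real.sqrt 2 * (C₁ * (1 + ε₀) ^ (-((n₀ : ℝ) / 2)))) *
              t ^ 2 / 2)) *
        (|Xr 2 0 0| + (|ε ^ 2 * Real.exp (-K ^ 10)| * 2 + C₁ * (1 + ε₀) ^ (-((n₀ : ℝ) / 2))) * t) := by
  have hq0 : (0 : ℝ) < 1 + ε₀ := by linarith
  have hη : 0 ≤ C₁ * (1 + ε₀) ^ (-((n₀ : ℝ) / 2)) := mul_nonneg hC₁ (Real.rpow_nonneg hq0.le _)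
  have hbase := h.zero_c_abs_le hC₁ hε₀ hτ0 hreg ht
  -- the rate integral via the affine bound on `|b₀|`
  have haff := integral_abs_mul_le_of_affine (h.continuousOn_X 1 0 hτ0 (b := T)) (μ := ε⁻¹ * K ^ 10)
    (p := Real.sqrt (Xr 1 0 0 ^ 2 + Xr 2 0 0 ^ 2))
    (σ := Real.sqrt 2 * ε * Real.sqrt 2 ^ 2 + Real.sqrt 2 * (C₁ * (1 + ε₀) ^ (-((n₀ : ℝ) / 2)))) ht
    (fun s hs => by
      have := (h.early_bc_abs_le hε hε1 hC₁ hε₀ hτ0 hreg ⟨hs.1, hs.2.trans ht.2⟩).1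
      rw [sub_zero]; exact this)
  rw [sub_zero] at haff
  -- the source integral via `a₀² ≤ 2`
  have hsrc : ∫ s in (0 : ℝ)..t, (|ε ^ 2 * Real.exp (-K ^ 10)| * Xr 0 0 s ^ 2 +
      C₁ * (1 + ε₀) ^ (-((n₀ : ℝ) / 2))) ≤
      (|ε ^ 2 * Real.exp (-K ^ 10)| * 2 + C₁ * (1 + ε₀) ^ (-((n₀ : ℝ) / 2))) * t := by
    have hc : ContinuousOn (fun s => |ε ^ 2 * Real.exp (-K ^ 10)| * Xr 0 0 s ^ 2 +
        C₁ * (1 + ε₀) ^ (-((n₀ : ℝ) / 2))) (Icc 0 t) :=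
      (continuousOn_const.mul ((h.continuousOn_X 0 0 hτ0).pow 2)).add continuousOn_const
    have h1 : ∫ s in (0 : ℝ)..t, (|ε ^ 2 * Real.exp (-K ^ 10)| * Xr 0 0 s ^ 2 +
        C₁ * (1 + ε₀) ^ (-((n₀ : ℝ) / 2))) ≤
        ∫ s in (0 : ℝ)..t, (|ε ^ 2 * Real.exp (-K ^ 10)| * 2 + C₁ * (1 + ε₀) ^ (-((n₀ : ℝ) / 2))) := by
      apply integral_mono_on ht.1 (hc.intervalIntegrable_of_Icc ht.1)
        (continuous_const.intervalIntegrable _ _)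
      intro s hs
      have hs2 := h.sq_le_two_mul_energy 0 0 (hτ0.trans hs.1)
      have hE := hreg s ⟨hs.1, hs.2.trans ht.2⟩
      have : Xr 0 0 s ^ 2 ≤ 2 := by linarith
      gcongr
    have h2 : ∫ s in (0 : ℝ)..t, (|ε ^ 2 * Real.exp (-K ^ 10)| * 2 + C₁ * (1 + ε₀) ^ (-((n₀ : ℝ) / 2))) =
        (|ε ^ 2 * Real.exp (-K ^ 10)| * 2 + C₁ * (1 + ε₀) ^ (-((n₀ : ℝ) / 2))) * t := by
      simp only [intervalIntegral.integral_const, smul_eq_mul]; ring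
    linarith
  have hsrc0 : 0 ≤ |Xr 2 0 0| + ∫ s in (0 : ℝ)..t, (|ε ^ 2 * Real.exp (-K ^ 10)| * Xr 0 0 s ^ 2 +
      C₁ * (1 + ε₀) ^ (-((n₀ : ℝ) / 2))) := by
    have : 0 ≤ ∫ s in (0 : ℝ)..t, (|ε ^ 2 * Real.exp (-K ^ 10)| * Xr 0 0 s ^ 2 +
        C₁ * (1 + ε₀) ^ (-((n₀ : ℝ) / 2))) :=
      integral_nonneg ht.1 fun s _ => by positivity
    positivity
  calc |Xr 2 0 t| ≤ _ := hbase
    _ ≤ Real.exp (|ε⁻¹ * K ^ 10| * (Real.sqrt (Xr 1 0 0 ^ 2 + Xr 2 0 0 ^ 2) * t +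
          (Real.sqrt 2 * ε * Real.sqrt 2 ^ 2 + Real.sqrt 2 * (C₁ * (1 + ε₀) ^ (-((n₀ : ℝ) / 2)))) *
            t ^ 2 / 2)) *
        (|Xr 2 0 0| + ∫ s in (0 : ℝ)..t, (|ε ^ 2 * Real.exp (-K ^ 10)| * Xr 0 0 s ^ 2 +
          C₁ * (1 + ε₀) ^ (-((n₀ : ℝ) / 2)))) :=
        mul_le_mul_of_nonneg_right (Real.exp_le_exp.2 haff) hsrc0
    _ ≤ _ := by
        apply mul_le_mul_of_nonneg_left _ (Real.exp_pos _).le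
        linarith

end Early

end TaoCascade

end Literature.Analysis.FluidPDE
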